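import Mathlib
import Summits.NavierStokesRegularity.NavierStokesRegularity.Theorems.EulerZoomLiouvillePowerGaugeEulerLiouvilleDSSEndpointSobolevSlices
import Summits.NavierStokesRegularity.NavierStokesRegularity.Theorems.EulerZoomLiouvillePowerGaugeEulerLiouvilleDSSEndpointSobolevSupDecay
import Summits.NavierStokesRegularity.NavierStokesRegularity.Theorems.EulerZoomLiouvillePowerGaugeEulerLiouvilleDSSEndpointMember
import HarnessLib

/-!
# Rung C2 of the crux `EulerZoomLiouville.PowerGaugeEulerLiouville` at the endpoint `ρ = 1/2` (weak class):
# DSS members (any factor) whose period shell energies are `≥ c₀L^{−5+η}`, `η > 5/2`, along unbounded radii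
# are trivial — NO growth hypothesis on the slices (the threshold of this seat's F-e was `η > 25/6`)

Route №10 `EulerZoomLiouville` (NavierStokesRegularity), crux E = stmt-NavierStokesRegularity-19832,
stub `stub_nonSelfSimilarRest`, DSS endpoint stratum `IsDSSPowerSpread` (growth-free disjunct).  MEMBER LEVEL
of the sup-in-time drain (`…DSSEndpointSobolevSupDecay`): the crux binders VERBATIM at `ρ = ½` —
`IsSuitableWeakSolutionOn`, `HasWeakSpatialGradientOn`, the gauge line — with the DSS clauses of the skeleton
(`u(τ,y) = l^{1+ρ}u(l^{2+ρ}τ, ly)`, `p(τ,y) = l^{2(1+ρ)}p(l^{2+ρ}τ, ly)`, any `l > 1`; the `p`-clause is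
supplied by DSS pressure slaving, `DSSPressureSlaving.inClass_dssPressure`) give the per-slice inputs
(`ae_slice_energy_of_gauge_half`, `ae_slice_cube_locallyIntegrable`, `ae_slice_pressure_velocity_locallyIntegrable`,
`ae_slice_riesz_of_gauge_half_of_weakGradient`), and `dss_iterate` moves any factor to `l^k ≥ 4`:

* `EndpointSobolev.dss_half_sliceEnergy_decay_of_gauge'` (portrait, any factor `l > 1`) — for every `ε > 0`
  a `C` with `∫_{L≤|y|<2L} |u(τ)|² ≤ C L^{−5/2+ε}` (`L ≥ 1`) for a.e. `τ` of the period `(l^{5/2}τ₀, τ₀)`;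
* `EndpointSobolev.dss_half_false_of_shellLower_sharp` (`l ≥ 4`), `…_sharp'` (any `l > 1`),
  `EndpointSobolev.dss_half_ae_eq_zero_of_shellLower_sharp'` (`Sig`-shaped) — plus the period shell lower
  bound `c₀L^{−5+η} ≤ ∫_{(l^{2+ρ}τ₀,τ₀)}∫_{L≤|y|<2L}|u|²` along radii beyond every bound with `η > 5/2`
  ⇒ `False` / `u = 0` a.e.

So the skeleton's growth-free `IsDSSPowerSpread` disjunct may read `25/6 ↦ 5/2`: the DSS endpoint stratum
now matches the centred one (`IsPowerSpreadProfile`, `η > 5/2`).  WHAT THIS IS NOT: not NS, not E, not the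
stub. [cite: ChaeShvydkoy2013, §3.1 Thm. 3.1; Xue2014DSSEuler, Thm 1.1 (ii)]
-/

noncomputable section

-- flat `Theorems/<Route><Decl>…` files of one crux share the namespace of the crux (tree convention)
set_option linter.dupNamespace false

open MeasureTheory Set Filter Topology Metric Function TopologicalSpace
open scoped ENNReal NNReal InnerProductSpace RealInnerProductSpace

namespace Summit.NavierStokesRegularity.NavierStokesRegularity.Theorems.PowerGaugeEulerLiouville

open Literature.Analysis Literature.Analysis.FunctionSpaces Literature.Analysis.FluidPDE

namespace EndpointSobolev

section MemberSharp

variable {u : ℝ → EuclideanSpace ℝ (Fin 3) → EuclideanSpace ℝ (Fin 3)}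
  {p : ℝ → EuclideanSpace ℝ (Fin 3) → ℝ}
  {H : ℝ → EuclideanSpace ℝ (Fin 3) → EuclideanSpace ℝ (Fin 3) →L[ℝ] EuclideanSpace ℝ (Fin 3)} {c : ℝ≥0}

/-- **No DSS member (factor `l ≥ 4`) with the period shell lower bound `c₀L^{−5+η}`, `η > 5/2`, in E's
class at `ρ = 1/2` — no growth hypothesis.**  Crux hypotheses verbatim; the per-slice class inputs feed
`dss_half_period_false_of_shellLower_of_weakGradient_sharp`. [cite: ChaeShvydkoy2013, §3.1 Thm. 3.1] -/
theorem dss_half_false_of_shellLower_sharp {ρ : ℝ} (hρ : ρ = 1 / 2)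
    (hsw : IsSuitableWeakSolutionOn (slab (EuclideanSpace ℝ (Fin 3)) (Iio 0) isOpen_Iio) 0 0 u p)
    (hH : HasWeakSpatialGradientOn (slab (EuclideanSpace ℝ (Fin 3)) (Iio 0) isOpen_Iio) u H)
    (hgauge : ∀ a : ℝ, 0 < a →
      ENNReal.ofReal (a ^ (2 * ρ)) * cknA a (0 : ℝ × EuclideanSpace ℝ (Fin 3)) u +
          ENNReal.ofReal (a ^ ρ) * cknE a (0 : ℝ × EuclideanSpace ℝ (Fin 3)) H +
        ENNReal.ofReal (a ^ (2 * ρ)) * cknD a (0 : ℝ × EuclideanSpace ℝ (Fin 3)) p ≤ (c : ℝ≥0∞))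
    {l : ℝ} (hl : 4 ≤ l)
    (hu : ∀ τ : ℝ, τ < 0 → ∀ y, u τ y = (l ^ (1 + ρ)) • u ((l ^ (2 + ρ)) * τ) (l • y))
    (hp : ∀ τ : ℝ, τ < 0 → ∀ y, p τ y = (l ^ (2 * (1 + ρ))) * p ((l ^ (2 + ρ)) * τ) (l • y))
    {τ₀ : ℝ} (hτ₀ : τ₀ < 0)
    {c₀ η : ℝ} (hc₀ : 0 < c₀) (hη : 5 / 2 < η)
    (hlow : ∀ L₁ : ℝ, ∃ L : ℝ, L₁ ≤ L ∧
      c₀ * L ^ (-(5 : ℝ) + η) ≤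
        ∫ τ in Ioo ((l ^ (2 + ρ)) * τ₀) τ₀,
          ∫ y in {y : EuclideanSpace ℝ (Fin 3) | L ≤ ‖y‖ ∧ ‖y‖ < 2 * L}, ‖u τ y‖ ^ 2) : False := by
  -- adapted from this seat's `dss_half_false_of_shellLower_of_weakGradient` (threshold 25/6)
  subst hρ
  have hl0 : 0 < l := by linarith
  have hA : ∀ a : ℝ, 0 < a → ENNReal.ofReal (a ^ (2 * (1 / 2 : ℝ))) *
      cknA a (0 : ℝ × EuclideanSpace ℝ (Fin 3)) u ≤ (c : ℝ≥0∞) :=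
    fun a ha => le_trans (le_trans le_self_add le_self_add) (hgauge a ha)
  have hE : ∀ a : ℝ, 0 < a → ENNReal.ofReal (a ^ (1 / 2 : ℝ)) *
      cknE a (0 : ℝ × EuclideanSpace ℝ (Fin 3)) H ≤ (c : ℝ≥0∞) :=
    fun a ha => le_trans (le_trans le_add_self le_self_add) (hgauge a ha)
  have hD : ∀ a : ℝ, 0 < a → ENNReal.ofReal (a ^ (2 * (1 / 2 : ℝ))) *
      cknD a (0 : ℝ × EuclideanSpace ℝ (Fin 3)) p ≤ (c : ℝ≥0∞) :=
    fun a ha => le_trans le_add_self (hgauge a ha)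
  have e1 : (1 : ℝ) + 1 / 2 = 3 / 2 := by norm_num
  have e2 : (2 : ℝ) + 1 / 2 = 5 / 2 := by norm_num
  have e3 : l ^ (2 * (1 + 1 / 2 : ℝ)) = l ^ 3 := by
    rw [show (2 : ℝ) * (1 + 1 / 2) = (3 : ℕ) by norm_num, Real.rpow_natCast]
  have hu' : ∀ τ : ℝ, τ < 0 → ∀ y, u τ y = (l ^ (3 / 2 : ℝ)) • u (l ^ (5 / 2 : ℝ) * τ) (l • y) := by
    intro τ hτ y; rw [hu τ hτ y, e1, e2]
  have hp' : ∀ τ : ℝ, τ < 0 → ∀ y, p τ y = l ^ 3 * p (l ^ (5 / 2 : ℝ) * τ) (l • y) := by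
    intro τ hτ y; rw [hp τ hτ y, e3, e2]
  have hum : AEStronglyMeasurable (uncurry u)
      (volume.restrict (Iio (0 : ℝ) ×ˢ (univ : Set (EuclideanSpace ℝ (Fin 3))))) := by
    have := hH.locallyIntegrableOn.aestronglyMeasurable
    simpa [slab] using this
  rw [e2] at hlow
  exact dss_half_period_false_of_shellLower_of_weakGradient_sharp hsw hH hE hl hu' hp' hτ₀
    (ae_slice_energy_of_gauge_half hum hA) (ae_slice_cube_locallyIntegrable hsw)
    (ae_slice_pressure_velocity_locallyIntegrable hsw) (R₁ := 1)
    (ae_slice_riesz_of_gauge_half_of_weakGradient hsw hH hA hE hD (α := l ^ (5 / 2 : ℝ) * τ₀) hτ₀)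
    hc₀ hη hlow

/-- **Any factor `l > 1`.**  A DSS member with factor `l > 1` is DSS with factor `l^k ≥ 4` (`dss_iterate`);
the shell lower bound on the ONE period `(l^{5/2}τ₀, τ₀)` bounds the integral over the `l^k`-period
`((l^k)^{5/2}τ₀, τ₀) ⊇ (l^{5/2}τ₀, τ₀)` from below (nonnegative integrand). [cite: ChaeShvydkoy2013, §3.1 Thm. 3.1] -/
theorem dss_half_false_of_shellLower_sharp' {ρ : ℝ} (hρ : ρ = 1 / 2)
    (hsw : IsSuitableWeakSolutionOn (slab (EuclideanSpace ℝ (Fin 3)) (Iio 0) isOpen_Iio) 0 0 u p)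
    (hH : HasWeakSpatialGradientOn (slab (EuclideanSpace ℝ (Fin 3)) (Iio 0) isOpen_Iio) u H)
    (hgauge : ∀ a : ℝ, 0 < a →
      ENNReal.ofReal (a ^ (2 * ρ)) * cknA a (0 : ℝ × EuclideanSpace ℝ (Fin 3)) u +
          ENNReal.ofReal (a ^ ρ) * cknE a (0 : ℝ × EuclideanSpace ℝ (Fin 3)) H +
        ENNReal.ofReal (a ^ (2 * ρ)) * cknD a (0 : ℝ × EuclideanSpace ℝ (Fin 3)) p ≤ (c : ℝ≥0∞))
    {l : ℝ} (hl : 1 < l)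
    (hu : ∀ τ : ℝ, τ < 0 → ∀ y, u τ y = (l ^ (1 + ρ)) • u ((l ^ (2 + ρ)) * τ) (l • y))
    (hp : ∀ τ : ℝ, τ < 0 → ∀ y, p τ y = (l ^ (2 * (1 + ρ))) * p ((l ^ (2 + ρ)) * τ) (l • y))
    {τ₀ : ℝ} (hτ₀ : τ₀ < 0)
    {c₀ η : ℝ} (hc₀ : 0 < c₀) (hη : 5 / 2 < η)
    (hlow : ∀ L₁ : ℝ, ∃ L : ℝ, L₁ ≤ L ∧
      c₀ * L ^ (-(5 : ℝ) + η) ≤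
        ∫ τ in Ioo ((l ^ (2 + ρ)) * τ₀) τ₀,
          ∫ y in {y : EuclideanSpace ℝ (Fin 3) | L ≤ ‖y‖ ∧ ‖y‖ < 2 * L}, ‖u τ y‖ ^ 2) : False := by
  -- adapted from this seat's `dss_half_false_of_shellLower_of_weakGradient'`
  subst hρ
  have hl0 : 0 < l := by linarith
  obtain ⟨k, hk⟩ := pow_unbounded_of_one_lt (4 : ℝ) hl
  have e2 : (2 : ℝ) + 1 / 2 = 5 / 2 := by norm_num
  rw [e2] at hlow
  have eb : (l ^ k) ^ (2 + 1 / 2 : ℝ) = (l ^ (5 / 2 : ℝ)) ^ k := by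
    rw [e2, ← Real.rpow_natCast l k, ← Real.rpow_mul hl0.le, ← Real.rpow_natCast (l ^ (5 / 2 : ℝ)) k,
      ← Real.rpow_mul hl0.le, mul_comm]
  have hA : ∀ a : ℝ, 0 < a → ENNReal.ofReal (a ^ (2 * (1 / 2 : ℝ))) *
      cknA a (0 : ℝ × EuclideanSpace ℝ (Fin 3)) u ≤ (c : ℝ≥0∞) :=
    fun a ha => le_trans (le_trans le_self_add le_self_add) (hgauge a ha)
  have hum : AEStronglyMeasurable (uncurry u)
      (volume.restrict (Iio (0 : ℝ) ×ˢ (univ : Set (EuclideanSpace ℝ (Fin 3))))) := by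
    have := hH.locallyIntegrableOn.aestronglyMeasurable
    simpa [slab] using this
  have hEn := ae_slice_energy_of_gauge_half hum hA
  -- the shell lower bound on the big window `((l^k)^{5/2} τ₀, τ₀) ⊇ (l^{5/2} τ₀, τ₀)`
  set b : ℝ := l ^ (5 / 2 : ℝ) with hb
  have hb1 : 1 < b := Real.one_lt_rpow hl (by norm_num)
  have hbk : (l ^ k) ^ (2 + 1 / 2 : ℝ) * τ₀ ≤ b * τ₀ := by
    rw [eb]
    have hk1 : 1 ≤ k := by
      by_contra h0
      have : k = 0 := by omega
      rw [this, pow_zero] at hk; linarith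
    have hbb : b ≤ b ^ k := le_self_pow₀ hb1.le (by omega)
    nlinarith
  have hlowW : ∀ L₁ : ℝ, ∃ L : ℝ, L₁ ≤ L ∧
      c₀ * L ^ (-(5 : ℝ) + η) ≤
        ∫ τ in Ioo ((l ^ k) ^ (2 + 1 / 2 : ℝ) * τ₀) τ₀,
          ∫ y in {y : EuclideanSpace ℝ (Fin 3) | L ≤ ‖y‖ ∧ ‖y‖ < 2 * L}, ‖u τ y‖ ^ 2 := by
    intro L₁
    obtain ⟨L, hLL₁, hL⟩ := hlow L₁
    refine ⟨L, hLL₁, hL.trans ?_⟩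
    obtain ⟨hif, hnn, -⟩ := period_sliceSetEnergy hum hEn (α := (l ^ k) ^ (2 + 1 / 2 : ℝ) * τ₀) hτ₀
      ((measurableSet_le measurable_const measurable_norm).inter
        (measurableSet_lt measurable_norm measurable_const) :
        MeasurableSet {y : EuclideanSpace ℝ (Fin 3) | L ≤ ‖y‖ ∧ ‖y‖ < 2 * L})
    exact setIntegral_mono_set hif
      ((ae_restrict_iff' measurableSet_Ioo).2 (hnn.mono fun τ hτ hτI => (hτ hτI).1))
      (Ioo_subset_Ioo_left hbk).eventuallyLE
  -- the member is DSS with factor `l^k ≥ 4`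
  obtain ⟨huk, hpk⟩ := dss_iterate hl0 hu hp k
  exact dss_half_false_of_shellLower_sharp (ρ := 1 / 2) rfl hsw hH hgauge hk.le huk hpk hτ₀ hc₀ hη hlowW

/-- **The growth-free DSS shell-lower stratum of rung C2 at the endpoint with the CENTRED threshold
`η > 5/2`, any factor, `Sig`-shaped**: vacuously trivial. [cite: ChaeShvydkoy2013, §3.1 Thm. 3.1] -/
theorem dss_half_ae_eq_zero_of_shellLower_sharp' {ρ : ℝ} (hρ : ρ = 1 / 2)
    (hsw : IsSuitableWeakSolutionOn (slab (EuclideanSpace ℝ (Fin 3)) (Iio 0) isOpen_Iio) 0 0 u p)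
    (hH : HasWeakSpatialGradientOn (slab (EuclideanSpace ℝ (Fin 3)) (Iio 0) isOpen_Iio) u H)
    (hgauge : ∀ a : ℝ, 0 < a →
      ENNReal.ofReal (a ^ (2 * ρ)) * cknA a (0 : ℝ × EuclideanSpace ℝ (Fin 3)) u +
          ENNReal.ofReal (a ^ ρ) * cknE a (0 : ℝ × EuclideanSpace ℝ (Fin 3)) H +
        ENNReal.ofReal (a ^ (2 * ρ)) * cknD a (0 : ℝ × EuclideanSpace ℝ (Fin 3)) p ≤ (c : ℝ≥0∞))
    {l : ℝ} (hl : 1 < l)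
    (hu : ∀ τ : ℝ, τ < 0 → ∀ y, u τ y = (l ^ (1 + ρ)) • u ((l ^ (2 + ρ)) * τ) (l • y))
    (hp : ∀ τ : ℝ, τ < 0 → ∀ y, p τ y = (l ^ (2 * (1 + ρ))) * p ((l ^ (2 + ρ)) * τ) (l • y))
    {τ₀ : ℝ} (hτ₀ : τ₀ < 0)
    {c₀ η : ℝ} (hc₀ : 0 < c₀) (hη : 5 / 2 < η)
    (hlow : ∀ L₁ : ℝ, ∃ L : ℝ, L₁ ≤ L ∧
      c₀ * L ^ (-(5 : ℝ) + η) ≤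
        ∫ τ in Ioo ((l ^ (2 + ρ)) * τ₀) τ₀,
          ∫ y in {y : EuclideanSpace ℝ (Fin 3) | L ≤ ‖y‖ ∧ ‖y‖ < 2 * L}, ‖u τ y‖ ^ 2) :
    uncurry u =ᵐ[volume.restrict (Iio (0 : ℝ) ×ˢ (univ : Set (EuclideanSpace ℝ (Fin 3))))] 0 :=
  (dss_half_false_of_shellLower_sharp' hρ hsw hH hgauge hl hu hp hτ₀ hc₀ hη hlow).elim

/-- **Every DSS endpoint member (any factor `l > 1`) drains slice-wise at the rate `L^{−5/2+ε}` — no growth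
hypothesis (portrait).**  Crux hypotheses verbatim at `ρ = 1/2` and the DSS clauses: for every `ε > 0`
there is `C` with `∫_{L≤|y|<2L} |u(τ,y)|² dy ≤ C L^{−5/2+ε}` for all `L ≥ 1` and a.e. `τ ∈ (l^{2+ρ}τ₀, τ₀)`.
[cite: ChaeShvydkoy2013, §3.1 proof of Thm. 3.1; Xue2014DSSEuler, Thm 1.1 (ii)] -/
theorem dss_half_sliceEnergy_decay_of_gauge' {ρ : ℝ} (hρ : ρ = 1 / 2)
    (hsw : IsSuitableWeakSolutionOn (slab (EuclideanSpace ℝ (Fin 3)) (Iio 0) isOpen_Iio) 0 0 u p)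
    (hH : HasWeakSpatialGradientOn (slab (EuclideanSpace ℝ (Fin 3)) (Iio 0) isOpen_Iio) u H)
    (hgauge : ∀ a : ℝ, 0 < a →
      ENNReal.ofReal (a ^ (2 * ρ)) * cknA a (0 : ℝ × EuclideanSpace ℝ (Fin 3)) u +
          ENNReal.ofReal (a ^ ρ) * cknE a (0 : ℝ × EuclideanSpace ℝ (Fin 3)) H +
        ENNReal.ofReal (a ^ (2 * ρ)) * cknD a (0 : ℝ × EuclideanSpace ℝ (Fin 3)) p ≤ (c : ℝ≥0∞))
    {l : ℝ} (hl : 1 < l)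
    (hu : ∀ τ : ℝ, τ < 0 → ∀ y, u τ y = (l ^ (1 + ρ)) • u ((l ^ (2 + ρ)) * τ) (l • y))
    (hp : ∀ τ : ℝ, τ < 0 → ∀ y, p τ y = (l ^ (2 * (1 + ρ))) * p ((l ^ (2 + ρ)) * τ) (l • y))
    {τ₀ : ℝ} (hτ₀ : τ₀ < 0) {ε : ℝ} (hε : 0 < ε) :
    ∃ C : ℝ, ∀ L : ℝ, 1 ≤ L → ∀ᵐ τ : ℝ, τ ∈ Ioo ((l ^ (2 + ρ)) * τ₀) τ₀ →
      ∫ y in {y : EuclideanSpace ℝ (Fin 3) | L ≤ ‖y‖ ∧ ‖y‖ < 2 * L}, ‖u τ y‖ ^ 2 ≤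
        C * L ^ (-(5 / 2 : ℝ) + ε) := by
  subst hρ
  have hl0 : 0 < l := by linarith
  have hA : ∀ a : ℝ, 0 < a → ENNReal.ofReal (a ^ (2 * (1 / 2 : ℝ))) *
      cknA a (0 : ℝ × EuclideanSpace ℝ (Fin 3)) u ≤ (c : ℝ≥0∞) :=
    fun a ha => le_trans (le_trans le_self_add le_self_add) (hgauge a ha)
  have hE : ∀ a : ℝ, 0 < a → ENNReal.ofReal (a ^ (1 / 2 : ℝ)) *
      cknE a (0 : ℝ × EuclideanSpace ℝ (Fin 3)) H ≤ (c : ℝ≥0∞) :=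
    fun a ha => le_trans (le_trans le_add_self le_self_add) (hgauge a ha)
  have hD : ∀ a : ℝ, 0 < a → ENNReal.ofReal (a ^ (2 * (1 / 2 : ℝ))) *
      cknD a (0 : ℝ × EuclideanSpace ℝ (Fin 3)) p ≤ (c : ℝ≥0∞) :=
    fun a ha => le_trans le_add_self (hgauge a ha)
  have e1 : (1 : ℝ) + 1 / 2 = 3 / 2 := by norm_num
  have e2 : (2 : ℝ) + 1 / 2 = 5 / 2 := by norm_num
  have e3 : l ^ (2 * (1 + 1 / 2 : ℝ)) = l ^ 3 := by
    rw [show (2 : ℝ) * (1 + 1 / 2) = (3 : ℕ) by norm_num, Real.rpow_natCast]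
  have hu' : ∀ τ : ℝ, τ < 0 → ∀ y, u τ y = (l ^ (3 / 2 : ℝ)) • u (l ^ (5 / 2 : ℝ) * τ) (l • y) := by
    intro τ hτ y; rw [hu τ hτ y, e1, e2]
  have hp' : ∀ τ : ℝ, τ < 0 → ∀ y, p τ y = l ^ 3 * p (l ^ (5 / 2 : ℝ) * τ) (l • y) := by
    intro τ hτ y; rw [hp τ hτ y, e3, e2]
  have hum : AEStronglyMeasurable (uncurry u)
      (volume.restrict (Iio (0 : ℝ) ×ˢ (univ : Set (EuclideanSpace ℝ (Fin 3))))) := by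
    have := hH.locallyIntegrableOn.aestronglyMeasurable
    simpa [slab] using this
  obtain ⟨k, hk⟩ := pow_unbounded_of_one_lt (4 : ℝ) (by linarith : (1 : ℝ) < l)
  rw [e2]
  have hlk0 : 0 < l ^ k := pow_pos hl0 k
  have hlk4 : (4 : ℝ) ≤ l ^ k := hk.le
  -- the member is DSS with factor `l^k ≥ 4`, in the `3/2, 5/2` normal form
  obtain ⟨huk, hpk⟩ := dss_iterate hl0 hu hp k
  have f1 : (l ^ k) ^ (1 + 1 / 2 : ℝ) = (l ^ k) ^ (3 / 2 : ℝ) := by rw [e1]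
  have f2 : (l ^ k) ^ (2 + 1 / 2 : ℝ) = (l ^ k) ^ (5 / 2 : ℝ) := by rw [e2]
  have f3 : (l ^ k) ^ (2 * (1 + 1 / 2 : ℝ)) = (l ^ k) ^ 3 := by
    rw [show (2 : ℝ) * (1 + 1 / 2) = (3 : ℕ) by norm_num, Real.rpow_natCast]
  have huk' : ∀ τ : ℝ, τ < 0 → ∀ y,
      u τ y = ((l ^ k) ^ (3 / 2 : ℝ)) • u ((l ^ k) ^ (5 / 2 : ℝ) * τ) ((l ^ k) • y) := by
    intro τ hτ y; rw [huk τ hτ y, f1, f2]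
  have hpk' : ∀ τ : ℝ, τ < 0 → ∀ y,
      p τ y = (l ^ k) ^ 3 * p ((l ^ k) ^ (5 / 2 : ℝ) * τ) ((l ^ k) • y) := by
    intro τ hτ y; rw [hpk τ hτ y, f3, f2]
  obtain ⟨C, hC⟩ := dss_half_sliceEnergy_decay_of_weakGradient hsw hH hE hlk4 huk' hpk' hτ₀
    (ae_slice_energy_of_gauge_half hum hA) (ae_slice_cube_locallyIntegrable hsw)
    (ae_slice_pressure_velocity_locallyIntegrable hsw) (R₁ := 1)
    (ae_slice_riesz_of_gauge_half_of_weakGradient hsw hH hA hE hD (α := (l ^ k) ^ (5 / 2 : ℝ) * τ₀) hτ₀)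
    hε
  -- the `l`-period `(l^{5/2}τ₀, τ₀)` lies inside the `l^k`-period
  have eb : (l ^ k) ^ (5 / 2 : ℝ) = (l ^ (5 / 2 : ℝ)) ^ k := by
    rw [← Real.rpow_natCast l k, ← Real.rpow_mul hl0.le, ← Real.rpow_natCast (l ^ (5 / 2 : ℝ)) k,
      ← Real.rpow_mul hl0.le, mul_comm]
  have hb1 : 1 < l ^ (5 / 2 : ℝ) := Real.one_lt_rpow (by linarith) (by norm_num)
  have hbk : (l ^ k) ^ (5 / 2 : ℝ) * τ₀ ≤ l ^ (5 / 2 : ℝ) * τ₀ := by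
    rw [eb]
    have hk1 : 1 ≤ k := by
      by_contra h0
      have : k = 0 := by omega
      rw [this, pow_zero] at hk; linarith
    have hbb : l ^ (5 / 2 : ℝ) ≤ (l ^ (5 / 2 : ℝ)) ^ k := le_self_pow₀ hb1.le (by omega)
    nlinarith
  refine ⟨C, fun L hL => ?_⟩
  filter_upwards [(hC L hL).1] with τ hτ hτI
  exact hτ (Ioo_subset_Ioo_left hbk hτI)

end MemberSharp

end EndpointSobolev

end Summit.NavierStokesRegularity.NavierStokesRegularity.Theorems.PowerGaugeEulerLiouville
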